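import Summits.Ventures.PercRepro.MSMinLost

/-!
# Sub-lemma (a) of the pair lemma: the free faces of an up-set of faces meeting a facet

Dossier proofs/MINE1-theoremS.md, Addendum 62 supplement 3. Let `P` be a simplicial complex on a
ground set `G` (`IsLowerIn G P`), `ū ∈ P` a facet, `u₀ = G ∖ ū` not a face, and `K ⊆ P` an up-set
within `P` of nonempty faces `≠ ū` that all meet `ū`. The **free faces** are the faces disjoint
from some member (`freeFaces P K`). Under the signs (†) — every face `t` has `t ∩ u₀` free or
`u₀ ∖ t` a face — **there are at least `|K| + 2` free faces**
(`card_add_two_le_card_freeFaces`).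

The proof is Theorem (MIN) (MSMinLost.lean) in the cube `2^G` with `D := P`, `A := ↑K` (the up-set
generated by `K`, `upGen G K`), `c := ū`: `P ∩ A = K`, `P ∩ cofG A` = the free faces, so the excess
is `|free| − |K|`; (H) holds since `ū ∖ m ∈ P` and `ū ∪ m ∉ P` at every minimal member `m`; Lemma X
gives excess `≥ 1`, and excess exactly one would make `ū ∖ m` the only crossed fibre of every
minimal `m` (RIGIDITY). Then (i) `u₀ ∖ m ∈ P` is impossible for every minimal `m`, so by (†) every
`m ∩ u₀` is free; (ii) minimal members with disjoint `u₀`-parts share their `ū`-part `c`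
(`rigidity` + the fact (S) that a face above `ū ∖ m` has `u₀`-part inside `m ∩ u₀`), a maximal
family of such members with pairwise disjoint `u₀`-parts `d_i` has `c ∪ ⋃ d_i ∈ P`, (†) at that
member forces `u₀ ∖ ⋃ d_i ∈ P` (a further member avoiding `⋃ d_i` would enlarge the family), and
rigidity at the members one at a time makes `u₀ = (u₀ ∖ ⋃ d_i) ∪ ⋃ d_i` a face — against `u₀ ∉ P`.
-/

namespace PercRepro.MSTight

open Finset
open scoped FinsetFamily

variable {α : Type*} [DecidableEq α]

section Defs

/-- The up-set of the cube `2^G` generated by a family `K`. -/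
def upGen (G : Finset α) (K : Finset (Finset α)) : Finset (Finset α) :=
  G.powerset.filter fun a => ∃ k ∈ K, k ⊆ a

/-- The faces of `P` disjoint from some member of `K`. -/
def freeFaces (P K : Finset (Finset α)) : Finset (Finset α) :=
  P.filter fun t => ∃ k ∈ K, Disjoint k t

variable {G : Finset α} {P K : Finset (Finset α)}

/-- Membership in `upGen`. -/
theorem mem_upGen {a : Finset α} : a ∈ upGen G K ↔ a ⊆ G ∧ ∃ k ∈ K, k ⊆ a := by
  simp [upGen]

/-- Membership in `freeFaces`. -/
theorem mem_freeFaces {t : Finset α} : t ∈ freeFaces P K ↔ t ∈ P ∧ ∃ k ∈ K, Disjoint k t := by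
  simp [freeFaces]

/-- `upGen G K` is an up-set of the cube. -/
theorem isUpperIn_upGen : IsUpperIn G (upGen G K) := by
  refine ⟨fun a ha => (mem_upGen.1 ha).1, ?_⟩
  intro a ha t hat htG
  obtain ⟨_, k, hk, hka⟩ := mem_upGen.1 ha
  exact mem_upGen.2 ⟨htG, k, hk, hka.trans hat⟩

/-- `∅ ∉ upGen G K` when `∅ ∉ K`. -/
theorem empty_notMem_upGen (hK : (∅ : Finset α) ∉ K) : (∅ : Finset α) ∉ upGen G K := by
  intro h
  obtain ⟨_, k, hk, hk0⟩ := mem_upGen.1 h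
  rw [subset_empty] at hk0
  exact hK (hk0 ▸ hk)

/-- `P ∩ upGen G K = K` for an up-set `K` within `P ⊆ 2^G`. -/
theorem inter_upGen_eq (hPG : ∀ t ∈ P, t ⊆ G) (hKP : K ⊆ P)
    (hup : ∀ k ∈ K, ∀ t ∈ P, k ⊆ t → t ∈ K) : P ∩ upGen G K = K := by
  ext a
  rw [mem_inter, mem_upGen]
  constructor
  · rintro ⟨ha, _, k, hk, hka⟩
    exact hup k hk a ha hka
  · intro ha
    exact ⟨hKP ha, hPG a (hKP ha), a, ha, Subset.refl a⟩

/-- `P ∩ cofG G (upGen G K) = freeFaces P K` for `P ⊆ 2^G`. -/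
theorem inter_cofG_upGen_eq (hPG : ∀ t ∈ P, t ⊆ G) (hKP : K ⊆ P) :
    P ∩ cofG G (upGen G K) = freeFaces P K := by
  ext t
  rw [mem_inter, mem_freeFaces, cofG, mem_image]
  constructor
  · rintro ⟨ht, a, ha, rfl⟩
    obtain ⟨_, k, hk, hka⟩ := mem_upGen.1 ha
    refine ⟨ht, k, hk, ?_⟩
    rw [disjoint_left]
    intro x hxk hxt
    exact (mem_sdiff.1 hxt).2 (hka hxk)
  · rintro ⟨ht, k, hk, hd⟩
    refine ⟨ht, G \ t, mem_upGen.2 ⟨sdiff_subset, k, hk, ?_⟩, ?_⟩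
    · intro x hxk
      exact mem_sdiff.2 ⟨hPG k (hKP hk) hxk, disjoint_left.1 hd hxk⟩
    · rw [Finset.sdiff_sdiff_eq_self (hPG t ht)]

end Defs

section Facet

variable {G : Finset α} {P K : Finset (Finset α)} {ub : Finset α}

/-- **The setting of sub-lemma (a)**: a complex `P` on `G`, a facet `ub`, the non-face
`u₀ = G ∖ ub`, a nonempty up-set `K ⊆ P ∖ {∅, ub}` of faces meeting `ub`, and the signs (†). -/
structure FacetData (G : Finset α) (P K : Finset (Finset α)) (ub : Finset α) : Prop where
  lower : IsLowerIn G P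
  ub_mem : ub ∈ P
  facet : ∀ t ∈ P, ub ⊆ t → t = ub
  compl_notMem : G \ ub ∉ P
  KP : K ⊆ P
  nonempty : K.Nonempty
  empty_notMem : (∅ : Finset α) ∉ K
  ub_notMem : ub ∉ K
  up : ∀ k ∈ K, ∀ t ∈ P, k ⊆ t → t ∈ K
  meets : ∀ k ∈ K, (k ∩ ub).Nonempty
  signs : ∀ t ∈ P, t ∩ (G \ ub) ∈ freeFaces P K ∨ (G \ ub) \ t ∈ P

namespace FacetData

variable (h : FacetData G P K ub)
include h

/-- Faces lie in `G`. -/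
theorem subset_G {t : Finset α} (ht : t ∈ P) : t ⊆ G := h.lower.1 t ht

/-- Subsets of faces are faces. -/
theorem mem_of_subset {t : Finset α} (ht : t ∈ P) {s : Finset α} (hs : s ⊆ t) : s ∈ P :=
  h.lower.2 hs ht

/-- A member is not contained in `ub`. -/
theorem not_subset_ub {k : Finset α} (hk : k ∈ K) : ¬ k ⊆ ub := fun hsub =>
  h.ub_notMem (h.up k hk ub h.ub_mem hsub)

/-- `ub ∖ k ≠ ∅` for a member `k`. -/
theorem sdiff_nonempty {k : Finset α} (hk : k ∈ K) : (ub \ k).Nonempty := by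
  rw [nonempty_iff_ne_empty, Ne, sdiff_eq_empty_iff_subset]
  intro hsub
  exact h.not_subset_ub hk (by
    have h1 := h.facet k (h.KP hk) hsub
    rw [h1])

/-- The `u₀`-part of a member is nonempty. -/
theorem inter_compl_nonempty {k : Finset α} (hk : k ∈ K) : (k ∩ (G \ ub)).Nonempty := by
  rw [nonempty_iff_ne_empty]
  intro he
  apply h.not_subset_ub hk
  intro x hx
  by_contra hxu
  have : x ∈ k ∩ (G \ ub) := mem_inter.2 ⟨hx, mem_sdiff.2 ⟨h.subset_G (h.KP hk) hx, hxu⟩⟩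
  rw [he] at this
  exact notMem_empty x this

/-- `ub ∪ k` is not a face for a member `k`. -/
theorem union_notMem {k : Finset α} (hk : k ∈ K) : ub ∪ k ∉ P := fun hmem =>
  h.not_subset_ub hk (by
    have h1 := h.facet _ hmem subset_union_left
    intro x hx
    have : x ∈ ub ∪ k := mem_union_right _ hx
    rw [h1] at this
    exact this)

/-- A minimal member of `upGen G K` is a minimal member of `K`. -/
theorem isMinIn_of_isMinIn_upGen {z : Finset α} (hz : IsMinIn (upGen G K) z) : IsMinIn K z := by
  obtain ⟨_, k, hk, hkz⟩ := mem_upGen.1 hz.1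
  have hkU : k ∈ upGen G K := mem_upGen.2 ⟨h.subset_G (h.KP hk), k, hk, Subset.refl k⟩
  have hkz' : k = z := hz.2 k hkU hkz
  subst hkz'
  refine ⟨hk, fun y hy hyk => ?_⟩
  exact hz.2 y (mem_upGen.2 ⟨h.subset_G (h.KP hy), y, hy, Subset.refl y⟩) hyk

/-- A minimal member of `K` is a minimal member of `upGen G K`. -/
theorem isMinIn_upGen_of_isMinIn {z : Finset α} (hz : IsMinIn K z) : IsMinIn (upGen G K) z := by
  refine ⟨mem_upGen.2 ⟨h.subset_G (h.KP hz.1), z, hz.1, Subset.refl z⟩, fun y hy hyz => ?_⟩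
  obtain ⟨_, k, hk, hky⟩ := mem_upGen.1 hy
  have := hz.2 k hk (hky.trans hyz)
  subst this
  exact Subset.antisymm hyz hky

/-- Hypothesis (H) of Theorem (MIN) with `c = ub`. -/
theorem hypH : HypH P (upGen G K) ub := by
  intro z hz
  have hzK := h.isMinIn_of_isMinIn_upGen hz
  exact ⟨h.mem_of_subset h.ub_mem sdiff_subset, h.union_notMem hzK.1⟩

/-- The excess of `P` against `upGen G K` is `|free| − |K|`. -/
theorem exc_eq : exc G P (upGen G K) = ((freeFaces P K).card : ℤ) - K.card := by
  rw [exc, inter_cofG_upGen_eq (fun t ht => h.subset_G ht) h.KP,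
    inter_upGen_eq (fun t ht => h.subset_G ht) h.KP h.up]

/-- Lemma X: the excess is at least one (`ub ∖ m` is a crossed fibre of a minimal `m`). -/
theorem one_le_exc : 1 ≤ exc G P (upGen G K) := by
  obtain ⟨k, hk⟩ := h.nonempty
  obtain ⟨m, hm, _⟩ := exists_isMinIn_subset hk
  refine one_le_exc_of_crossSet_nonempty h.lower isUpperIn_upGen (h.isMinIn_upGen_of_isMinIn hm)
    ⟨ub \ m, ?_⟩
  rw [crossSet, mem_filter]
  refine ⟨h.mem_of_subset h.ub_mem sdiff_subset, sdiff_disjoint, ?_⟩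
  rw [sdiff_union_self_eq_union]
  exact h.union_notMem hm.1

/-- **Rigidity** (Theorem (MIN) with `c = ub`): if the excess is exactly one, `ub ∖ m` is the only
crossed fibre of every minimal member `m`. -/
theorem crossSet_eq (h1 : exc G P (upGen G K) = 1) {m : Finset α} (hm : IsMinIn K m) :
    crossSet P m = {ub \ m} :=
  crossSet_eq_singleton h.lower isUpperIn_upGen (empty_notMem_upGen h.empty_notMem)
    (h.subset_G h.ub_mem) h.hypH h1 (h.isMinIn_upGen_of_isMinIn hm)

/-! ### The consequences of rigidity -/

omit h in
/-- A face disjoint from a minimal `m`, other than `ub ∖ m`, extends by `m`. -/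
theorem union_mem_of_rigid (hrig : ∀ m, IsMinIn K m → crossSet P m = {ub \ m}) {m : Finset α}
    (hm : IsMinIn K m) {v : Finset α} (hv : v ∈ P) (hd : Disjoint v m) (hne : v ≠ ub \ m) :
    v ∪ m ∈ P := by
  by_contra hcon
  have : v ∈ crossSet P m := by
    rw [crossSet, mem_filter]
    exact ⟨hv, hd, hcon⟩
  rw [hrig m hm, mem_singleton] at this
  exact hne this

/-- **(S)** A face above `ub ∖ m` has its `u₀`-part inside `m ∩ u₀`. -/
theorem inter_compl_subset_of_rigid (hrig : ∀ m, IsMinIn K m → crossSet P m = {ub \ m})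
    {m : Finset α} (hm : IsMinIn K m) {w : Finset α} (hw : w ∈ P) (hsub : ub \ m ⊆ w) :
    w ∩ (G \ ub) ⊆ m ∩ (G \ ub) := by
  intro a ha
  rw [mem_inter] at ha ⊢
  refine ⟨?_, ha.2⟩
  by_contra ham
  have hau : a ∉ ub := (mem_sdiff.1 ha.2).2
  have hv : insert a (ub \ m) ∈ P :=
    h.mem_of_subset hw (insert_subset ha.1 hsub)
  have hd : Disjoint (insert a (ub \ m)) m := by
    rw [disjoint_insert_left]
    exact ⟨ham, sdiff_disjoint⟩
  have hne : insert a (ub \ m) ≠ ub \ m := fun e =>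
    hau (mem_sdiff.1 (e ▸ mem_insert_self a _)).1
  have hmem := union_mem_of_rigid hrig hm hv hd hne
  have hsub' : ub ⊆ insert a (ub \ m) ∪ m := by
    intro x hx
    by_cases hxm : x ∈ m
    · exact mem_union_right _ hxm
    · exact mem_union_left _ (mem_insert_of_mem (mem_sdiff.2 ⟨hx, hxm⟩))
  have heq := h.facet _ hmem hsub'
  exact hau (by rw [← heq]; exact mem_union_left _ (mem_insert_self a _))

/-- **(i)** `u₀ ∖ m` is not a face for a minimal `m`. -/
theorem compl_sdiff_notMem_of_rigid (hrig : ∀ m, IsMinIn K m → crossSet P m = {ub \ m})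
    {m : Finset α} (hm : IsMinIn K m) : (G \ ub) \ m ∉ P := by
  intro hv
  have hd : Disjoint ((G \ ub) \ m) m := sdiff_disjoint
  have hne : (G \ ub) \ m ≠ ub \ m := by
    intro e
    -- both sides are empty: the left avoids `ub`, the right lies in `ub`
    have he : (G \ ub) \ m = ∅ := by
      rw [eq_empty_iff_forall_notMem]
      intro x hx
      have hx' := hx
      rw [e] at hx'
      exact (mem_sdiff.1 (mem_sdiff.1 hx).1).2 (mem_sdiff.1 hx').1
    rw [sdiff_eq_empty_iff_subset] at he
    exact h.compl_notMem (h.mem_of_subset (h.KP hm.1) he)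
  have hmem := union_mem_of_rigid hrig hm hv hd hne
  apply h.compl_notMem
  refine h.mem_of_subset hmem ?_
  intro x hx
  by_cases hxm : x ∈ m
  · exact mem_union_right _ hxm
  · exact mem_union_left _ (mem_sdiff.2 ⟨hx, hxm⟩)

/-- **(ii)** Minimal members with disjoint `u₀`-parts have the same `ub`-part. -/
theorem inter_ub_subset_of_rigid (hrig : ∀ m, IsMinIn K m → crossSet P m = {ub \ m})
    {m m' : Finset α} (hm : IsMinIn K m) (hm' : IsMinIn K m')
    (hd : Disjoint (m ∩ (G \ ub)) (m' ∩ (G \ ub))) : m ∩ ub ⊆ m' ∩ ub := by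
  have hv : (ub \ m) \ m' ∈ P := h.mem_of_subset h.ub_mem (sdiff_subset.trans sdiff_subset)
  have hdv : Disjoint ((ub \ m) \ m') m' := sdiff_disjoint
  by_cases hne : (ub \ m) \ m' = ub \ m'
  · intro x hx
    rw [mem_inter] at hx ⊢
    refine ⟨?_, hx.2⟩
    by_contra hxm'
    have : x ∈ ub \ m' := mem_sdiff.2 ⟨hx.2, hxm'⟩
    rw [← hne] at this
    exact (mem_sdiff.1 (mem_sdiff.1 this).1).2 hx.1
  · exfalso
    have hmem := union_mem_of_rigid hrig hm' hv hdv hne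
    have hsub : ub \ m ⊆ (ub \ m) \ m' ∪ m' := by
      intro x hx
      by_cases hxm' : x ∈ m'
      · exact mem_union_right _ hxm'
      · exact mem_union_left _ (mem_sdiff.2 ⟨hx, hxm'⟩)
    have hS := h.inter_compl_subset_of_rigid hrig hm hmem hsub
    obtain ⟨a, ha⟩ := h.inter_compl_nonempty hm'.1
    have ha1 : a ∈ ((ub \ m) \ m' ∪ m') ∩ (G \ ub) :=
      mem_inter.2 ⟨mem_union_right _ (mem_inter.1 ha).1, (mem_inter.1 ha).2⟩
    have ha2 := hS ha1
    exact disjoint_left.1 hd ha2 ha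

/-- Minimal members with disjoint `u₀`-parts have equal `ub`-parts. -/
theorem inter_ub_eq_of_rigid (hrig : ∀ m, IsMinIn K m → crossSet P m = {ub \ m})
    {m m' : Finset α} (hm : IsMinIn K m) (hm' : IsMinIn K m')
    (hd : Disjoint (m ∩ (G \ ub)) (m' ∩ (G \ ub))) : m ∩ ub = m' ∩ ub :=
  Subset.antisymm (h.inter_ub_subset_of_rigid hrig hm hm' hd)
    (h.inter_ub_subset_of_rigid hrig hm' hm hd.symm)

/-- A member is the union of its `ub`-part and its `u₀`-part. -/
theorem eq_union_parts {k : Finset α} (hk : k ∈ P) : k = k ∩ ub ∪ k ∩ (G \ ub) := by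
  ext x
  simp only [mem_union, mem_inter, mem_sdiff]
  constructor
  · intro hx
    by_cases hxu : x ∈ ub
    · exact Or.inl ⟨hx, hxu⟩
    · exact Or.inr ⟨hx, h.subset_G hk hx, hxu⟩
  · rintro (⟨hx, _⟩ | ⟨hx, _⟩) <;> exact hx

end FacetData

end Facet

end PercRepro.MSTight
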